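import Literature.AlgebraicGeometry.Modules.SerreTwistModProjMap
import Literature.AlgebraicGeometry.Morphisms.ProjectiveSpaceOverAffine
import HarnessLib

/-!
# A `Proj R[x₀, …, x_r]`-embedding of an `R`-scheme is an embedding into `𝐏(ι; Spec R)` with the same Serre twists
# (the (I-EMB) chart currency over an affine base; Görtz–Wedhorn (4.12), Hartshorne II Prop. 5.12 (c))

Layer `Literature/AlgebraicGeometry/Modules`, namespace `Literature.AlgebraicGeometry.Modules.SerreTwist`; THEOREMS ONLY (no definition,
no instance, no notation, no named fact, no `sorry`).  Cell `hodgecm-mathlib` (D-0151), P6 «MOD programme» (crux hLiu418 =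
stmt-HodgeConjecture-24832, `--supports`, count-neutral); P-LINE ED. 2 leaf `Lines/F0_P6a_PELSpread.lean`, socket `stub_INJ0`, organ (GS-3b1)
«`toProj` CHART ↦ (I-EMB) CHART» of the census `F0/P6/A-p14/g35/CENSUS-stubINJ0-globalfamily.v2` §4 (A-p14 (g35) 02:20:03Z offer; LA4-p03).
HC_CM is proved only modulo the printed citations until rung 0 closes; nothing here is about HC.

THE MATHEMATICS ([GortzWedhorn2020] (4.12) p. 113: «if `S = Spec R` is affine, `ℙⁿ_{Spec R}` is the projective space `ℙⁿ_R`»;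
[Hartshorne1977] II Prop. 5.12 (c); [StacksProject] Tag 01NF, Tag 01MX).  The tree reads projective embeddings in TWO currencies: over an
affine base, `φ : X → Proj R[x₀, …, x_r] = PP R r` over `Spec R` (★ `Motives/MorphismsToProjectiveSpace.toProj`, ★ REL-EMB
`PolarizedAbelianSchemeLocalEmbedding`), and over any base `S`, `j : X → 𝐏(ι; S) = S ×_{Spec ℤ} 𝐏^{#ι}_ℤ` with `𝒪(1)` read through the
`𝐏_ℤ`-coordinate `j ≫ pr` (★ `Morphisms/AffineSpaceCompactification`; the (I-EMB) binders of ★ (G2) ∕ the SP3-a2 line).  ★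
`Morphisms/ProjectiveSpaceOverAffine` identifies `PP R (#ι) ≅ 𝐏(ι; Spec R)` over `Spec R`, compatibly with the base-change map
`π : PP R r → PP ℤ r` (`Proj.map (ℤ[x] → R[x])`), and ★ `Modules/SerreTwistModProjMap` (Part B) identifies the Serre twists along `φ` and
along `φ ≫ π`.  Hence: **a (closed) `Spec R`-embedding `φ : X ↪ PP R r` yields a (closed) `Spec R`-embedding `j : X ↪ 𝐏(ι; Spec R)`
(`#ι = r`) over the same structure map with `twistMod (j ≫ pr) N e ≅ twistMod φ N e` for every sheaf of modules `N` and every `e`.**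

MAIN STATEMENTS.  `exists_embedding_projectiveSpace_of_embedding_PP` (general `ι`, `Nat.card ι = r`; closedness transferred both ways as
an `↔`), **`exists_isClosedImmersion_projectiveSpace_of_PP`** (the consumer form: closed in, closed out), and the `Fin m` corollary
**`exists_isClosedImmersion_projectiveSpace_fin_of_PP`** (`φ : X ↪ PP R m` ↦ `j : X ↪ 𝐏(Fin m; Spec R)`).

## References
* [GortzWedhorn2020] U. Görtz, T. Wedhorn, *Algebraic Geometry I: Schemes*, 2nd ed. (2020), Section (4.12) (p. 113); Remark 13.27.
* [Hartshorne1977] R. Hartshorne, *Algebraic Geometry* (1977), II §4 (p. 103), II Prop. 5.12 (c) (p. 117).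
* [StacksProject] The Stacks Project, Tag 01NF, Tag 01MX.
-/

noncomputable section

-- Mathlib's pull-back API is stated through `abbrev`s over `limit` (as in the ★ `Morphisms/*` files).
set_option backward.isDefEq.respectTransparency false

open CategoryTheory CategoryTheory.Limits AlgebraicGeometry TopologicalSpace Opposite

universe u

namespace Literature.AlgebraicGeometry.Modules

namespace SerreTwist

open Literature.AlgebraicGeometry.Morphisms Literature.AlgebraicGeometry.Morphisms.ProjCech Literature.AlgebraicGeometry.Motives

variable {R : Type u} [CommRing R] [Algebra intU.{u} R] {X : Scheme.{u}} {ι : Type u}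

/-- **A `Spec R`-morphism `φ : X → Proj R[x₀, …, x_r]` IS a `Spec R`-morphism `j : X → 𝐏(ι; Spec R)` (`#ι = r`) with the same Serre twists**:
`j := φ ≫ (PP R r ≅ 𝐏(ι; Spec R))` (★ `isPullback_projToSpec_projMap_terminal`), over the same structure map, `j` a closed immersion iff `φ`
is, and `twistMod (j ≫ pr_{𝐏_ℤ}) N e ≅ twistMod φ N e` (★ Part B `exists_twistMod_comp_projMap_iso` at `ℤ → R`, since `j ≫ pr = φ ≫ Proj.map (ℤ[x] → R[x])`).
[cite: GortzWedhorn2020, Section (4.12) (p. 113)] [cite: Hartshorne1977, II Prop. 5.12 (c)] [cite: StacksProject, Tag 01MX] -/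
theorem exists_embedding_projectiveSpace_of_embedding_PP {r : ℕ} (hr : Nat.card ι = r) (φ : X ⟶ PP R r) :
    ∃ j : X ⟶ Morphisms.projectiveSpace ι (Spec (.of R)),
      (IsClosedImmersion j ↔ IsClosedImmersion φ) ∧ j ≫ Morphisms.projectiveSpaceFst ι (Spec (.of R)) = φ ≫ toSpec R r ∧
      ∀ (N : X.Modules) (e : ℕ),
        Nonempty (twistMod (j ≫ pullback.snd (terminal.from (Spec (.of R))) (terminal.from (Morphisms.projectiveSpaceInt ι))) N e ≅
          twistMod φ N e) := by
  subst hr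
  let E := (isPullback_projToSpec_projMap_terminal ι R).isoPullback
  refine ⟨φ ≫ E.hom, ⟨fun h => ?_, fun h => inferInstance⟩, ?_, fun N e => ?_⟩
  · have : IsClosedImmersion ((φ ≫ E.hom) ≫ E.inv) := inferInstance
    simpa only [Category.assoc, Iso.hom_inv_id, Category.comp_id] using this
  · rw [Category.assoc, projectiveSpaceSpec_isoPullback_hom_fst]
  · -- `j ≫ pr = φ ≫ Proj.map (ℤ[x] → R[x])`, then ★ Part B
    obtain ⟨ψ, -⟩ := exists_twistMod_comp_projMap_iso intU.{u} R φ N e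
    have hsnd := congrArg (fun q => twistMod (φ ≫ q) N e) (projectiveSpaceSpec_isoPullback_hom_snd ι R)
    rw [← Category.assoc] at hsnd
    exact ⟨eqToIso hsnd ≪≫ ψ⟩

/-- **THE (I-EMB) CHART FROM A `Proj R[x]`-EMBEDDING** (consumer form): a CLOSED `Spec R`-immersion `φ : X ↪ Proj R[x₀, …, x_r]` over
`f : X → Spec R` yields a CLOSED `Spec R`-immersion `j : X ↪ 𝐏(ι; Spec R)` (`#ι = r`) over `f` with `twistMod (j ≫ pr_{𝐏_ℤ}) N e ≅ twistMod φ N e`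
for all `N`, `e` — so an `𝒪(1)`-identification for `φ` (e.g. ★ `nonempty_twistMod_toProj_iso`) becomes one for `j`.
[cite: GortzWedhorn2020, Section (4.12) (p. 113)] [cite: Hartshorne1977, II Prop. 5.12 (c)] [cite: StacksProject, Tag 01NF] -/
theorem exists_isClosedImmersion_projectiveSpace_of_PP {r : ℕ} (hr : Nat.card ι = r) (f : X ⟶ Spec (.of R)) (φ : X ⟶ PP R r)
    (hφ : φ ≫ toSpec R r = f) [IsClosedImmersion φ] :
    ∃ j : X ⟶ Morphisms.projectiveSpace ι (Spec (.of R)),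
      j ≫ Morphisms.projectiveSpaceFst ι (Spec (.of R)) = f ∧ IsClosedImmersion j ∧
      ∀ (N : X.Modules) (e : ℕ),
        Nonempty (twistMod (j ≫ pullback.snd (terminal.from (Spec (.of R))) (terminal.from (Morphisms.projectiveSpaceInt ι))) N e ≅
          twistMod φ N e) := by
  obtain ⟨j, hjc, hjf, hje⟩ := exists_embedding_projectiveSpace_of_embedding_PP (R := R) (ι := ι) hr φ
  exact ⟨j, hjf.trans hφ, hjc.mpr inferInstance, hje⟩

/-- **The `Fin m` form**: a closed `Spec R`-immersion `φ : X ↪ Proj R[x₀, …, x_m] = PP R m` over `f` yields a closed `Spec R`-immersion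
`j : X ↪ 𝐏(Fin m; Spec R)` over `f` with `twistMod (j ≫ pr_{𝐏_ℤ}) N e ≅ twistMod φ N e` — the binders `(j, hj, hjc)` of the (I-EMB) data of ★ (G2)
`PolarizedTupleIsomPiecesOfCharts` ∕ the SP3-a2 line, over an affine chart. [cite: GortzWedhorn2020, Section (4.12) (p. 113)]
[cite: Hartshorne1977, II Prop. 5.12 (c)] [cite: StacksProject, Tag 01NF] -/
theorem exists_isClosedImmersion_projectiveSpace_fin_of_PP {R : Type} [CommRing R] [Algebra intU.{0} R] {X : Scheme.{0}} {m : ℕ}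
    (f : X ⟶ Spec (.of R)) (φ : X ⟶ PP R m) (hφ : φ ≫ toSpec R m = f) [IsClosedImmersion φ] :
    ∃ j : X ⟶ Morphisms.projectiveSpace (Fin m) (Spec (.of R)),
      j ≫ Morphisms.projectiveSpaceFst (Fin m) (Spec (.of R)) = f ∧ IsClosedImmersion j ∧
      ∀ (N : X.Modules) (e : ℕ),
        Nonempty (twistMod (j ≫ pullback.snd (terminal.from (Spec (.of R))) (terminal.from (Morphisms.projectiveSpaceInt (Fin m)))) N e ≅
          twistMod φ N e) :=
  exists_isClosedImmersion_projectiveSpace_of_PP (ι := Fin m) (Nat.card_fin m) f φ hφ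

end SerreTwist

end Literature.AlgebraicGeometry.Modules

end
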